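import Summits.HubbardSuperconductivity.Statement
import Summits.HubbardSuperconductivity.HubbardSuperconductivity.Theorems.FunctionFieldCertificateAssemblyFejerGlue
import HarnessLib

/-!
# Route `FunctionFieldCertificate` — the Assembly (item `stmt-HubbardSuperconductivity-7335`), structural form

The assembly item of route `HubbardSuperconductivity/FunctionFieldCertificate` is
`Assembly := MesoscopicPairOrder → WindowInfraredBound → HubbardSuperconductivity`, literally the type
of the route's deciding theorem `closes`. Unlike the pure-logic assemblies of the sibling routes it
carries a piece of finite Fourier analysis on the dual torus `(ℤ/Lℤ)²` — the Fejér-kernel Parseval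
glue of the route thesis — which is proved here in full:

* `MesoscopicPairOrder` (crux 2, pole-free half): at one `(U, δ)` there is `m > 0` such that for
  arbitrarily large scales `R`, all large even `L` and EVERY normalised `(N_L, S^z = 0)`-sector ground
  state `ψ` of `hubbardTorus 2 L 1 U`, the Fejér-box average of the `d`-wave pair correlation obeys
  `L⁻² Σ_{x,y} Πᵢ (1 - |(y-x)ᵢ|_L/R)₊ Re⟨P_x ψ, P_y ψ⟩ ≥ m R²` (`P_x = localPair dWaveFormFactor L x`);
* `WindowInfraredBound` (crux 4, pole half, shared with route KacWindowPenalty): for every `(U, δ)`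
  there are `C ≥ 0`, `ε₀ > 0`, `L₀` with `Σ_{m ≠ 0, |q_m| ≤ ε} ‖Δ_d(m)ψ‖²/L² ≤ C ε L²` for all
  `ε ∈ (0, ε₀]`, even `L ≥ L₀` and every normalised sector ground state (`Δ_d(m) = pairFieldAt`).

PROOF (the route's `## Assembly` paragraph, constants adapted to the tree's Fejér closure). Fix the
`(U, δ, m)` of crux 2 and the `(C, ε₀, L₀)` of crux 4 at that `(U, δ)`; put
`ε := min ε₀ (m / (8(C+1)))` (so `C ε ≤ m/8`) and `K := 2π² C_d² / ε²` with the tree's local pair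
norm constant `C_d = Σ_{e ∈ {0} ∪ unitSteps} 2|g_d(e)|/√2`; crux 2 supplies a scale `R ≥ ⌈8K/m⌉ + 1`
(so `K/R² ≤ m/8`) and its threshold `L₁`. For even `L ≥ max (max L₁ L₀) (2R)` and a normalised
sector ground state `ψ`:
1. BLOCK SUM = FEJÉR BOX (tree lemma `FunctionFieldCertificateAssembly.re_sum_star_blockMulVec_dotProduct_eq`
   of `Theorems/FunctionFieldCertificateAssemblyFejerGlue.lean`): with the wrapped blocks
   `B_a = Σ_{u ∈ [0,R)²} P_{a+u}` one has `Σ_a ‖B_a ψ‖² = R² Σ_{x,y} Πᵢ (1 - |(y-x)ᵢ|_L/R)₊ Re⟨P_xψ,P_yψ⟩`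
   as soon as `2R ≤ L` (autocorrelation count `#{(s,t) ∈ [0,R)² : t - s ≡ z (mod L)} = (R - |z|_L)₊`,
   no wrap-around because `|t - s| < R ≤ L/2`); hence `Σ_a ‖B_a ψ‖²/(R⁴L²) ≥ m` by crux 2.
2. FEJÉR CLOSURE (tree theorem `WcbcsSsbToTorusLRO.stub_fejerClosure`, block Plancherel + kernel
   bounds + pair sum rule): `Σ_a ‖B_aψ‖²/(R⁴L²) - Σ_{m≠0,|q_m|²<ε²} S_ψ(m)/L² - K/R² ≤ Re⟨Δ_dᴴΔ_d⟩/L⁴`.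
3. WINDOW: the strict window `|q_m|² < ε²` sits inside crux 4's window `|q_m|² ≤ ε²`
   (`momentumNormSq`, `pairStructureFactor ≥ 0`; the route's `D` IS `pairFieldAt dWaveFormFactor L`
   by `rfl`), so its pair weight is `≤ C ε L²`.
Hence `Re⟨ψ, Δ_dᴴ Δ_d ψ⟩/L⁴ ≥ m - m/8 - m/8 ≥ m/2` for every such `ψ`, and the summit's
`HasLongRangeOrder` along even sides follows by the standard `liminf` bookkeeping
(`hasLRO_of_uniform_groundState_bound`: `torusLROSeq_pairFieldCorr_succ`, boundedness
`pairFieldCorr_succ_le`), for every admissible sequence `(N, ψ)` of the Statement.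

DESIGN (summit precedent: `Theorems/AposterioriCapRgAssembly.lean`, `Theorems/ThermalWedgeAssemblyStructural.lean`):
the TYPE is spelled out STRUCTURALLY — the verbatim bodies of the route decls `MesoscopicPairOrder`
and `WindowInfraredBound` (Theses/FunctionFieldCertificate.lean rev 5) and the summit constant
`_root_.HubbardSuperconductivity` — and this module imports only `Summits.HubbardSuperconductivity.Statement`,
Literature modules and cycle-free Theorems modules, NOT the Theses module: the gate appends
`Assembly_holds := _root_.<this theorem>` to the Theses file by importing this module there, so a
Theses import here would close an import cycle. The type is definitionally equal (δ-unfolding of the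
three defs) to `Summit.HubbardSuperconductivity.HubbardSuperconductivity.Theses.FunctionFieldCertificate.Assembly`
(checked in a scratch file importing both: `theorem t : …Theses.FunctionFieldCertificate.Assembly :=
functionFieldCertificate_assembly_structural` elaborates, and so does `unfold MesoscopicPairOrder
WindowInfraredBound; with_reducible exact …`). No definition is introduced; the window lemma is
private; the `liminf` bookkeeping `hasLRO_of_uniform_groundState_bound` is kept public (general form
factor and Hamiltonian).

Sources: Kennedy–Lieb–Shastry, PRL 61 (1988) 2582 (k-space bookkeeping of an order operator,
Parseval sum rule) [KLS1988PRL]; Dyson–Lieb–Simon, J. Stat. Phys. 18 (1978) 335, Thms 3.1–4.2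
[DysonLiebSimon1978]; Scalapino, Phys. Rep. 250 (1995) 329, §2 eq. (2.4) [Scalapino1995];
Stein–Shakarchi, *Fourier Analysis*, Ch. 2 (Fejér kernel as an autocorrelation) [folklore].
-/

noncomputable section

-- the summit namespace `Summit.HubbardSuperconductivity.HubbardSuperconductivity.…` repeats the problem name by design (D-0017)
set_option linter.dupNamespace false

namespace Summit.HubbardSuperconductivity.HubbardSuperconductivity.Theorems

open Matrix Finset Filter
open Literature.Probability.LatticeModels Literature.MathematicalPhysics.QuantumLattice
open scoped ComplexOrder

namespace FunctionFieldCertificateAssemblyStructural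

/-! ### `liminf` bookkeeping: a uniform every-ground-state bound gives the summit's matrix -/

/-- `|(ℤ/Lℤ)²| = L²` as a real number (`L ≠ 0`). [folklore] -/
private theorem card_torusSite_two_real (L : ℕ) [NeZero L] :
    ((Finset.univ : Finset (TorusSite 2 L)).card : ℝ) = (L : ℝ) ^ 2 := by
  simp only [Finset.card_univ, Fintype.card_pi, Finset.prod_const, ZMod.card, Fintype.card_fin]
  push_cast
  ring

/-- **Uniform every-ground-state bound ⇒ pair-field LRO along even sides.** Fix a form factor
`g`, Hamiltonians `H L`, sector labels `(Nf L, M)` and `c > 0`. If for all even sides `L ≥ L₀`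
EVERY normalised sector ground state `ψ` of `H L` obeys `c L⁴ ≤ re ⟨ψ, Δ_g† Δ_g ψ⟩`, then every
admissible sequence `(N, ψ)` (prescribed particle number `N L = Nf L`, normalisation and ground-state
property at the even sides) has pair-field long-range order along the even sides in the summit's
format, `HasLongRangeOrder (fun k => halfOpenBox 2 (2k)) (fun k => torusPullback (pairFieldCorr g ψ) (2k))`:
the LRO sequence is eventually `≥ c` (`torusLROSeq_pairFieldCorr_succ`) and bounded above by `C_g²`
at every `k ≥ 1` (`pairFieldCorr_succ_le`, using only the normalisation at side `2k`), so its
`liminf` is `≥ c > 0`. (The `g = dWaveFormFactor`, `H L = hubbardTorus 2 L 1 U` case is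
`hasLRO_of_forall_groundState_bound` of `Theorems/BalabanIRBirEveryGroundState.lean`; the general
form is re-proved here with Literature-only imports.) Scalapino, Phys. Rep. 250 (1995) 329, §2
eq. (2.4); Friedli–Velenik (2017) §3.7.2, Def. 3.27. [folklore] -/
theorem hasLRO_of_uniform_groundState_bound (g : Site 2 → ℝ)
    (H : ∀ L : ℕ, Matrix (Finset (Orb (FermionTorus 2 L))) (Finset (Orb (FermionTorus 2 L))) ℂ)
    (Nf : ℕ → ℕ) (M c : ℝ) (hc : 0 < c) (L₀ : ℕ)
    (h : ∀ (L : ℕ) [NeZero L], L₀ ≤ L → Even L → ∀ ψ : Fock (Orb (FermionTorus 2 L)),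
      IsGroundStateInSector (H L) (Nf L) M ψ → star ψ ⬝ᵥ ψ = 1 →
      c * (L : ℝ) ^ 4 ≤ (star ψ ⬝ᵥ ((pairField g L)ᴴ * pairField g L) *ᵥ ψ).re)
    (N : ℕ → ℕ) (ψ : ∀ L, Fock (Orb (FermionTorus 2 L)))
    (hadm : ∀ L, Even L → N L = Nf L ∧ star (ψ L) ⬝ᵥ ψ L = 1 ∧
      IsGroundStateInSector (H L) (N L) M (ψ L)) :
    HasLongRangeOrder (fun k => halfOpenBox 2 (2 * k))
      (fun k => torusPullback (pairFieldCorr g ψ) (2 * k)) := by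
  unfold HasLongRangeOrder
  set Cd : ℝ := ∑ e ∈ insert 0 unitSteps, ‖((g e / Real.sqrt 2 : ℝ) : ℂ)‖ * 2
    with hCd
  -- the LRO sequence at a positive side `m + 1`, for a vector normalised there, is `≤ C_g²`
  have hup' : ∀ m : ℕ, star (ψ (m + 1)) ⬝ᵥ ψ (m + 1) = 1 →
      (∑ x ∈ halfOpenBox 2 (m + 1), ∑ y ∈ halfOpenBox 2 (m + 1),
        torusPullback (pairFieldCorr g ψ) (m + 1) x y) /
          ((halfOpenBox 2 (m + 1)).card : ℝ) ^ 2 ≤ Cd ^ 2 := by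
    intro m hnorm
    rw [torusLROSeq_pairFieldCorr_succ, div_le_iff₀ (by positivity), ← sum_pairFieldCorr_succ]
    calc ∑ x : TorusSite 2 (m + 1), ∑ y, pairFieldCorr g ψ (m + 1) x y
        ≤ ∑ _x : TorusSite 2 (m + 1), ∑ _y : TorusSite 2 (m + 1), Cd ^ 2 :=
          Finset.sum_le_sum fun x _ => Finset.sum_le_sum fun y _ =>
            pairFieldCorr_succ_le g ψ m hnorm x y
      _ = Cd ^ 2 * ((m + 1 : ℕ) : ℝ) ^ 4 := by
          rw [Finset.sum_const, Finset.sum_const, smul_smul, nsmul_eq_mul, Nat.cast_mul,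
            card_torusSite_two_real]
          push_cast
          ring
  -- the LRO sequence at a good even side `m + 1 ≥ L₀` is `≥ c`
  have hlow' : ∀ m : ℕ, L₀ ≤ m + 1 → Even (m + 1) →
      c ≤ (∑ x ∈ halfOpenBox 2 (m + 1), ∑ y ∈ halfOpenBox 2 (m + 1),
        torusPullback (pairFieldCorr g ψ) (m + 1) x y) /
          ((halfOpenBox 2 (m + 1)).card : ℝ) ^ 2 := by
    intro m hm hev
    obtain ⟨hN, hunit, hgs⟩ := hadm (m + 1) hev
    rw [hN] at hgs
    have hb := h (m + 1) hm hev (ψ (m + 1)) hgs hunit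
    rw [torusLROSeq_pairFieldCorr_succ, le_div_iff₀ (by positivity)]
    exact hb
  -- upper bound at every `k` (uses only the normalisation at the even side `2k`)
  have hup : ∀ k : ℕ, (∑ x ∈ halfOpenBox 2 (2 * k), ∑ y ∈ halfOpenBox 2 (2 * k),
      torusPullback (pairFieldCorr g ψ) (2 * k) x y) /
        ((halfOpenBox 2 (2 * k)).card : ℝ) ^ 2 ≤ Cd ^ 2 := by
    intro k
    cases k with
    | zero =>
      have h0 : ((halfOpenBox 2 (2 * 0)).card : ℝ) ^ 2 = 0 := by rw [card_halfOpenBox]; simp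
      rw [h0, div_zero]
      positivity
    | succ k =>
      have hev : Even (2 * k + 1 + 1) := ⟨k + 1, by ring⟩
      exact hup' (2 * k + 1) (hadm (2 * k + 1 + 1) hev).2.1
  -- lower bound, eventually
  have hlow : ∀ᶠ k : ℕ in atTop, c ≤ (∑ x ∈ halfOpenBox 2 (2 * k), ∑ y ∈ halfOpenBox 2 (2 * k),
      torusPullback (pairFieldCorr g ψ) (2 * k) x y) /
        ((halfOpenBox 2 (2 * k)).card : ℝ) ^ 2 := by
    refine eventually_atTop.2 ⟨L₀ + 1, fun k hk => ?_⟩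
    obtain ⟨k, rfl⟩ : ∃ k', k = k' + 1 := ⟨k - 1, by omega⟩
    have hev : Even (2 * k + 1 + 1) := ⟨k + 1, by ring⟩
    exact hlow' (2 * k + 1) (by omega) hev
  exact lt_of_lt_of_le hc
    (le_liminf_of_le (isCoboundedUnder_ge_of_eventually_le _ (Eventually.of_forall hup)) hlow)

variable {L : ℕ} [NeZero L]

/-! ### The window: strict inside non-strict, and the route's `D` is `pairFieldAt` -/

/-- The route's window sum (literal `if`-form over all momenta, window `|q_m|² ≤ ε²`, with
`D m = pairFieldAt dWaveFormFactor L m` by `rfl`) dominates the strict-window sum of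
`stub_fejerClosure` (`|q_m|² < ε²`), termwise by `pairStructureFactor ≥ 0`. [folklore] -/
private theorem strictWindow_le_window (ε : ℝ) (ψ : Fock (Orb (FermionTorus 2 L))) :
    (∑ m ∈ (Finset.univ.filter fun m : TorusSite 2 L => m ≠ 0 ∧ momentumNormSq L m < ε ^ 2),
        pairStructureFactor dWaveFormFactor L ψ m) ≤
      ∑ m : Fin 2 → ZMod L, if m ≠ 0 ∧ (2 * Real.pi / (L : ℝ)) ^ 2 *
          (∑ i : Fin 2, (((m i).valMinAbs : ℤ) : ℝ) ^ 2) ≤ ε ^ 2 then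
        (star (Matrix.mulVec (pairFieldAt dWaveFormFactor L m) ψ) ⬝ᵥ
          Matrix.mulVec (pairFieldAt dWaveFormFactor L m) ψ).re / (L : ℝ) ^ 2 else 0 := by
  rw [← Finset.sum_filter]
  refine Finset.sum_le_sum_of_subset_of_nonneg (fun m hm => ?_) (fun m _ _ => ?_)
  · simp only [Finset.mem_filter, Finset.mem_univ, true_and] at hm ⊢
    exact ⟨hm.1, (le_of_eq (momentumNormSq_apply m).symm).trans hm.2.le⟩
  · exact pairStructureFactor_nonneg dWaveFormFactor L ψ m

end FunctionFieldCertificateAssemblyStructural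

open FunctionFieldCertificateAssemblyStructural WcbcsSsbToTorusLRO

/-- **Assembly of route `FunctionFieldCertificate` (item `stmt-HubbardSuperconductivity-7335`),
stated structurally**: (crux 2 `MesoscopicPairOrder`, body verbatim) → (crux 4
`WindowInfraredBound`, body verbatim) → `HubbardSuperconductivity`. Fejér–Parseval glue on the
dual torus `(ℤ/Lℤ)²`: with `ε := min ε₀ (m/(8(C+1)))`, `K := 2π²C_d²/ε²`, a crux-2 scale
`R ≥ ⌈8K/m⌉ + 1` and even `L ≥ max (max L₁ L₀) (2R)`, every normalised sector ground state has
`Re⟨ψ, Δ_dᴴΔ_d ψ⟩/L⁴ ≥ Σ_a‖B_aψ‖²/(R⁴L²) - (window pair weight)/L² - K/R² ≥ m - m/8 - m/8 ≥ m/2`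
(`re_sum_star_blockMulVec_dotProduct_eq` + crux 2 for the first term, `stub_fejerClosure` for the inequality, crux 4 via
`strictWindow_le_window` for the second, the choice of `R` for the third); then
`hasLRO_of_uniform_groundState_bound`. Same type, up to `δ`-unfolding, as the route decl
`Summit.HubbardSuperconductivity.HubbardSuperconductivity.Theses.FunctionFieldCertificate.Assembly`.
Kennedy–Lieb–Shastry, PRL 61 (1988) 2582; Dyson–Lieb–Simon (1978) Thms 3.1–4.2; Scalapino (1995)
§2 eq. (2.4). [folklore] -/
theorem functionFieldCertificate_assembly_structural :
    (∃ U : ℝ, 0 < U ∧ ∃ δ ∈ Set.Ioo (0:ℝ) (1 / 2), ∃ m : ℝ, 0 < m ∧ ∀ R₀ : ℕ, ∃ R : ℕ, R₀ ≤ R ∧ ∃ L₀ : ℕ, ∀ (L : ℕ) [NeZero L], L₀ ≤ L → Even L → ∀ ψ : Literature.MathematicalPhysics.QuantumLattice.Fock (Literature.MathematicalPhysics.QuantumLattice.Orb (Literature.MathematicalPhysics.QuantumLattice.FermionTorus 2 L)), star ψ ⬝ᵥ ψ = 1 → Literature.MathematicalPhysics.QuantumLattice.IsGroundStateInSector (Literature.MathematicalPhysics.QuantumLattice.hubbardTorus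 2 L 1 U) (2 * ⌊(1 - δ) * (L : ℝ) ^ 2 / 2⌋₊) 0 ψ → m * (R : ℝ) ^ 2 ≤ (∑ x : Fin 2 → ZMod L, ∑ y : Fin 2 → ZMod L, (∏ i : Fin 2, max 0 (1 - |(((y i - x i).valMinAbs : ℤ) : ℝ)| / (R : ℝ))) * (star (Matrix.mulVec (Literature.MathematicalPhysics.QuantumLattice.localPair Literature.MathematicalPhysics.QuantumLattice.dWaveFormFactor L x) ψ) ⬝ᵥ Matrix.mulVec (Literature.MathematicalPhysics.QuantumLattice.localPair Literature.MathematicalPhysics.QuantumLattice.dWaveFormFactor L y) ψ).re) / (L : ℝ) ^ 2) →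
    (∀ U : ℝ, 0 < U → ∀ δ ∈ Set.Ioo (0:ℝ) (1 / 2), ∃ C ε₀ : ℝ, 0 ≤ C ∧ 0 < ε₀ ∧ ∃ L₀ : ℕ, ∀ ε ∈ Set.Ioc (0:ℝ) ε₀, ∀ (L : ℕ) [NeZero L], L₀ ≤ L → Even L → let D : (Fin 2 → ZMod L) → Matrix (Finset (Literature.MathematicalPhysics.QuantumLattice.Orb (Literature.MathematicalPhysics.QuantumLattice.FermionTorus 2 L))) (Finset (Literature.MathematicalPhysics.QuantumLattice.Orb (Literature.MathematicalPhysics.QuantumLattice.FermionTorus 2 L))) ℂ := fun m => ∑ x : Fin 2 → ZMod L, Complex.exp (-(2 * Real.pi * Complex.I * (((∑ i : Fin 2, m i * x i).val : ℕ) : ℂ) / (L : ℂ))) • Literature.MathematicalPhysics.QuantumLattice.localPair Literature.MathematicalPhysics.QuantumLattice.dWaveFormFactor L x; ∀ ψ : Literature.MathematicalPhysics.QuantumLattice.Fock (Literature.MathematicalPhysics.QuantumLattice.Orb (Literature.MathematicalPhysics.QuantumLattice.FermionTorus 2 L)), star ψ ⬝ᵥ ψ = 1 → Literature.MathematicalPhysics.QuantumLattice.IsGroundStateInSector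 (Literature.MathematicalPhysics.QuantumLattice.hubbardTorus 2 L 1 U) (2 * ⌊(1 - δ) * (L : ℝ) ^ 2 / 2⌋₊) 0 ψ → (∑ m : Fin 2 → ZMod L, if m ≠ 0 ∧ (2 * Real.pi / (L : ℝ)) ^ 2 * (∑ i : Fin 2, (((m i).valMinAbs : ℤ) : ℝ) ^ 2) ≤ ε ^ 2 then (star (Matrix.mulVec (D m) ψ) ⬝ᵥ Matrix.mulVec (D m) ψ).re / (L : ℝ) ^ 2 else 0) ≤ C * ε * (L : ℝ) ^ 2) →
    _root_.HubbardSuperconductivity := by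
  rintro ⟨U, hU, δ, hδ, m, hm, hMeso⟩ hWin
  obtain ⟨C, ε₀, hC, hε₀, L₂, hW⟩ := hWin U hU δ hδ
  -- constants
  set Cd : ℝ := ∑ e ∈ insert (0 : Site 2) unitSteps, ‖((dWaveFormFactor e / Real.sqrt 2 : ℝ) : ℂ)‖ * 2
    with hCd
  set ε : ℝ := min ε₀ (m / (8 * (C + 1))) with hε
  have hC1 : 0 < C + 1 := by linarith
  have hεpos : 0 < ε := lt_min hε₀ (by positivity)
  have hεmem : ε ∈ Set.Ioc (0 : ℝ) ε₀ := ⟨hεpos, min_le_left _ _⟩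
  have hCε : C * ε ≤ m / 8 := by
    have h1 : ε ≤ m / (8 * (C + 1)) := min_le_right _ _
    calc C * ε ≤ (C + 1) * (m / (8 * (C + 1))) :=
          mul_le_mul (by linarith) h1 hεpos.le hC1.le
      _ = m / 8 := by field_simp
  set K : ℝ := 2 * Real.pi ^ 2 * Cd ^ 2 / ε ^ 2 with hK
  have hKnn : 0 ≤ K := by positivity
  obtain ⟨R, hR₀R, L₁, hM⟩ := hMeso (⌈8 * K / m⌉₊ + 1)
  have hRpos : 0 < R := by omega
  have hRr : (0 : ℝ) < R := Nat.cast_pos.2 hRpos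
  have hR8 : 8 * K / m ≤ (R : ℝ) :=
    (Nat.le_ceil _).trans (by exact_mod_cast (by omega : ⌈8 * K / m⌉₊ ≤ R))
  have htail : K / (R : ℝ) ^ 2 ≤ m / 8 := by
    have h1 : 8 * K ≤ m * R := by rw [div_le_iff₀ hm] at hR8; linarith
    have h2 : m * R ≤ m * (R : ℝ) ^ 2 := by
      have : (R : ℝ) ≤ (R : ℝ) ^ 2 := by
        have h1R : (1 : ℝ) ≤ R := by exact_mod_cast hRpos
        nlinarith
      exact mul_le_mul_of_nonneg_left this hm.le
    rw [div_le_div_iff₀ (by positivity) (by norm_num : (0:ℝ) < 8)]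
    linarith
  -- the uniform every-ground-state bound at `(U, δ)`
  have key : ∀ (L : ℕ) [NeZero L], max (max L₁ L₂) (2 * R) ≤ L → Even L →
      ∀ ψ : Fock (Orb (FermionTorus 2 L)),
      IsGroundStateInSector (hubbardTorus 2 L 1 U) (2 * ⌊(1 - δ) * (L : ℝ) ^ 2 / 2⌋₊) 0 ψ →
      star ψ ⬝ᵥ ψ = 1 →
      m / 2 * (L : ℝ) ^ 4 ≤
        (star ψ ⬝ᵥ ((pairField dWaveFormFactor L)ᴴ * pairField dWaveFormFactor L) *ᵥ ψ).re := by
    intro L _ hL hev ψ hgs hψ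
    have hL₁ : L₁ ≤ L := le_trans (le_trans (le_max_left _ _) (le_max_left _ _)) hL
    have hL₂ : L₂ ≤ L := le_trans (le_trans (le_max_right _ _) (le_max_left _ _)) hL
    have h2R : 2 * R ≤ L := le_trans (le_max_right _ _) hL
    have hLr : (0 : ℝ) < L := Nat.cast_pos.2 (Nat.pos_of_ne_zero (NeZero.ne L))
    -- crux 2: the Fejér-box average
    have hmeso := hM L hL₁ hev ψ hψ hgs
    -- crux 4: the window pair weight
    have hwin₀ := hW ε hεmem L hL₂ hev
    have hwin : (∑ m ∈ (Finset.univ.filter fun m : TorusSite 2 L => m ≠ 0 ∧ momentumNormSq L m < ε ^ 2),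
        pairStructureFactor dWaveFormFactor L ψ m) ≤ C * ε * (L : ℝ) ^ 2 :=
      (strictWindow_le_window ε ψ).trans (hwin₀ ψ hψ hgs)
    -- the Fejér closure of the tree
    have hstub := stub_fejerClosure dWaveFormFactor L R hRpos ε hεpos ψ hψ
    rw [FunctionFieldCertificateAssembly.re_sum_star_blockMulVec_dotProduct_eq R hRpos h2R] at hstub
    -- the block term is `≥ m`
    have hblock : m ≤ (R : ℝ) ^ 2 * (∑ x : TorusSite 2 L, ∑ y : TorusSite 2 L,
        (∏ i : Fin 2, max 0 (1 - |(((y i - x i).valMinAbs : ℤ) : ℝ)| / (R : ℝ))) *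
          (star (localPair dWaveFormFactor L x *ᵥ ψ) ⬝ᵥ (localPair dWaveFormFactor L y *ᵥ ψ)).re) /
        ((R : ℝ) ^ 4 * (L : ℝ) ^ 2) := by
      rw [le_div_iff₀ (by positivity)] at hmeso ⊢
      nlinarith [hmeso]
    -- the window term is `≤ m/8`
    have hwin' : (∑ m ∈ (Finset.univ.filter fun m : TorusSite 2 L => m ≠ 0 ∧ momentumNormSq L m < ε ^ 2),
        pairStructureFactor dWaveFormFactor L ψ m) / (L : ℝ) ^ 2 ≤ m / 8 := by
      rw [div_le_iff₀ (by positivity)]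
      calc _ ≤ C * ε * (L : ℝ) ^ 2 := hwin
        _ ≤ m / 8 * (L : ℝ) ^ 2 := mul_le_mul_of_nonneg_right hCε (by positivity)
    -- the tail term is `≤ m/8`
    have htail' : 2 * Real.pi ^ 2 * Cd ^ 2 / ((R : ℝ) ^ 2 * ε ^ 2) ≤ m / 8 := by
      have : 2 * Real.pi ^ 2 * Cd ^ 2 / ((R : ℝ) ^ 2 * ε ^ 2) = K / (R : ℝ) ^ 2 := by
        rw [hK]; field_simp
      rw [this]; exact htail
    -- assemble
    have hE : m / 2 ≤ (expect ((pairField dWaveFormFactor L)ᴴ * pairField dWaveFormFactor L) ψ).re /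
        (L : ℝ) ^ 4 := by linarith
    rw [le_div_iff₀ (by positivity)] at hE
    exact hE
  -- conclude: the summit's matrix at `(U, δ)`
  show Literature.Hubbard.DWaveSuperconductivityHubbard
  exact ⟨U, hU, δ, hδ, fun N ψ hadm =>
    hasLRO_of_uniform_groundState_bound dWaveFormFactor (fun L => hubbardTorus 2 L 1 U)
      (fun L => 2 * ⌊(1 - δ) * (L : ℝ) ^ 2 / 2⌋₊) 0 (m / 2) (by positivity) (max (max L₁ L₂) (2 * R))
      (fun L _ hL hev φ hgs hφ => key L hL hev φ hgs hφ) N ψ hadm⟩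

end Summit.HubbardSuperconductivity.HubbardSuperconductivity.Theorems
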